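import Literature.Computability.QuantumComplexity.QubitRouting
import Literature.Computability.QuantumComplexity.BarencoControlledGates
import Literature.Computability.QuantumComplexity.PathModelGadgetDefect
import HarnessLib

/-!
# The gates `{H, Z, CZ, CCZ}` as products of adjacent-qubit primitives

Topic `Literature/Computability/QuantumComplexity`. Proof infrastructure for the
`PromiseBQP`-hardness of the Jones polynomial at `k = 5` (Aharonov–Arad 2011, Thm. 3.1). The
reduction simulates a circuit over the sign basis `{H, Z, CZ, CCZ}` (QSIM, `QSimSign.lean`) by
braids; the braid toolbox realises, up to compilation error, exactly the following PRIMITIVES on an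
`n`-qubit register: a Hadamard or a `Z` on one wire, and a controlled phase
`CP_{a,a+1}(u) = diag(1,1,1,u)`, `u ∈ {-1, i, -i}`, on two ADJACENT wires (`Gadget.ctrlPhase` of
`PathModelGadgetDefect.lean`). This file gives the exact matrix identities expressing every
placed gate of the sign basis as a product of primitives:

* `cphase u` (two-qubit `diag(1,1,1,u)`) and the bridges `placeGate_pairEmb_cphase`
  (= Barenco's `mc {c} t (m2 1 0 0 u)`), `placeGate_pairEmb_cphase_adj` (= `Gadget.ctrlPhase`),
  `cz_eq_cphase`, `placeGate_ccsign_eq_mc`;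
* `placeGate_cz_eq_conj` — a `CZ` on wires `(i, j)` is the conjugate by a wire permutation of an
  adjacent `CZ` (`QubitRouting`, `permGate_mul_placeGate_mul_symm`), and the permutation is a
  product of adjacent transpositions each of which is a product of adjacent `CZ`s and Hadamards
  (`permGate_swap_eq_prod`);
* `placeGate_ccsign_eq_prod` — **Barenco et al. Lemma 6.1/7.5 for `CCZ`**:
  `CCZ_{abc} = CS_{bc} · CNOT_{ab} · CS†_{bc} · CNOT_{ab} · CS_{ac}` with `CNOT_{ab} = H_b CZ_{ab} H_b`
  (`Barenco.mc_insert_diag_sq` with `v = i`), every factor a placed `cphase` or Hadamard.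

## References

* D. Aharonov, I. Arad, New J. Phys. 13 (2011) 035019, §3.2 [AharonovArad2011].
* A. Barenco et al., Phys. Rev. A 52 (1995) 3457, Lemmas 6.1, 7.5 [BarencoEtAl1995].
-/

noncomputable section

namespace Literature.Computability.QuantumComplexity

open Matrix Cryptography Complex

variable {n : ℕ}

/-! ### The controlled phase on two wires -/

/-- **`CP(u) = diag(1, 1, 1, u)`** on two wires. [cite: BarencoEtAl1995, §2] -/
def cphase (u : ℂ) : Matrix (QReg 2) (QReg 2) ℂ :=
  Matrix.diagonal fun x => if x 0 = true ∧ x 1 = true then u else 1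

/-- `CZ = CP(-1)`. [folklore] -/
theorem cz_eq_cphase : cz = cphase (-1) := by
  rw [cz_eq_diagonal, cphase]

/-- **A placed `CP(u)` is Barenco's singly-controlled `diag(1, u)`.** [cite: BarencoEtAl1995, §2] -/
theorem placeGate_pairEmb_cphase {c t : Fin n} (h : c ≠ t) (u : ℂ) :
    placeGate (pairEmb c t h) (cphase u) = Barenco.mc {c} t (OneQubit.m2 1 0 0 u) := by
  rw [cphase, placeGate_diagonal, Barenco.mc_diag (by simpa using h.symm)]
  congr 1
  funext x
  simp only [Function.comp_apply, pairEmb_zero, pairEmb_one, Finset.mem_singleton, forall_eq]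
  by_cases hc : x c = true
  · simp [hc]
  · simp [hc]

/-- A placed `CP(u)` is symmetric in its two wires. [folklore] -/
theorem placeGate_pairEmb_cphase_comm {c t : Fin n} (h : c ≠ t) (u : ℂ) :
    placeGate (pairEmb c t h) (cphase u) = placeGate (pairEmb t c h.symm) (cphase u) := by
  rw [cphase, placeGate_diagonal, placeGate_diagonal]
  congr 1
  funext x
  simp only [Function.comp_apply, pairEmb_zero, pairEmb_one]
  by_cases hc : x c = true <;> by_cases ht : x t = true <;> simp [hc, ht]

/-- **On adjacent wires a placed `CP(u)` is the gadget's `ctrlPhase`.** [cite: AharonovArad2011, §3.2] -/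
theorem placeGate_pairEmb_cphase_adj (a : ℕ) (ha : a + 2 ≤ n) (u : ℂ) :
    placeGate (pairEmb (⟨a, by omega⟩ : Fin n) ⟨a + 1, by omega⟩ (by simp)) (cphase u) = Gadget.ctrlPhase a ha u := by
  rw [cphase, placeGate_diagonal, Gadget.ctrlPhase]
  congr 1

/-- A placed `CCZ` is Barenco's doubly-controlled `diag(1, -1)`. [cite: BarencoEtAl1995, §2] -/
theorem placeGate_ccsign_eq_mc (e : Fin 3 ↪ Fin n) :
    placeGate e ccsign = Barenco.mc {e 0, e 1} (e 2) (OneQubit.m2 1 0 0 (-1)) := by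
  have h02 : e 0 ≠ e 2 := fun h => by have := e.injective h; simp at this
  have h12 : e 1 ≠ e 2 := fun h => by have := e.injective h; simp at this
  rw [ccsign, placeGate_diagonal, Barenco.mc_diag (by simp [h02.symm, h12.symm])]
  congr 1
  funext x
  simp only [Function.comp_apply, Finset.mem_insert, Finset.mem_singleton, forall_eq_or_imp, forall_eq]
  by_cases h0 : x (e 0) = true <;> by_cases h1 : x (e 1) = true <;> simp [h0, h1]

/-! ### One- and two-qubit gates of the basis as placed primitives -/

/-- Every `Fin 2`-embedding is a `pairEmb`. [folklore] -/
theorem eq_pairEmb (e : Fin 2 ↪ Fin n) : e = pairEmb (e 0) (e 1) (fun h => by have := e.injective h; simp at this) := by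
  ext i
  fin_cases i <;> rfl

/-- **A placed `CZ` is a conjugate, by a wire permutation, of the adjacent `CZ`**: if `π (e 0) = a`
and `π (e 1) = a + 1` then `placeGate e cz = P_{π⁻¹} · ctrlPhase a (-1) · P_π`.
[cite: AharonovArad2011, §3.2] -/
theorem placeGate_cz_eq_conj (e : Fin 2 ↪ Fin n) (π : Equiv.Perm (Fin n)) (a : ℕ) (ha : a + 2 ≤ n)
    (h0 : π (e 0) = ⟨a, by omega⟩) (h1 : π (e 1) = ⟨a + 1, by omega⟩) :
    placeGate e cz = permGate π.symm * Gadget.ctrlPhase a ha (-1) * permGate π := by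
  have hcov := permGate_mul_placeGate_mul_symm π e cz
  have he : e.trans π.toEmbedding = pairEmb (⟨a, by omega⟩ : Fin n) ⟨a + 1, by omega⟩ (by simp) := by
    ext i; fin_cases i
    · exact congrArg Fin.val h0
    · exact congrArg Fin.val h1
  rw [he, cz_eq_cphase, placeGate_pairEmb_cphase_adj a ha] at hcov
  rw [cz_eq_cphase, ← hcov]
  rw [← Matrix.mul_assoc, ← Matrix.mul_assoc, permGate_symm_mul_permGate, Matrix.one_mul, Matrix.mul_assoc,
    permGate_symm_mul_permGate, Matrix.mul_one]

/-- The same for `CP(u)` on arbitrary wires `(c, t)`. [cite: AharonovArad2011, §3.2] -/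
theorem placeGate_cphase_eq_conj {c t : Fin n} (hct : c ≠ t) (u : ℂ) (π : Equiv.Perm (Fin n)) (a : ℕ) (ha : a + 2 ≤ n)
    (h0 : π c = ⟨a, by omega⟩) (h1 : π t = ⟨a + 1, by omega⟩) :
    placeGate (pairEmb c t hct) (cphase u) = permGate π.symm * Gadget.ctrlPhase a ha u * permGate π := by
  have hcov := permGate_mul_placeGate_mul_symm π (pairEmb c t hct) (cphase u)
  have he : (pairEmb c t hct).trans π.toEmbedding = pairEmb (⟨a, by omega⟩ : Fin n) ⟨a + 1, by omega⟩ (by simp) := by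
    ext i; fin_cases i
    · exact congrArg Fin.val h0
    · exact congrArg Fin.val h1
  rw [he, placeGate_pairEmb_cphase_adj a ha] at hcov
  rw [← hcov, ← Matrix.mul_assoc, ← Matrix.mul_assoc, permGate_symm_mul_permGate, Matrix.one_mul, Matrix.mul_assoc,
    permGate_symm_mul_permGate, Matrix.mul_one]

/-! ### `CCZ` from controlled-`S`, `CNOT` (Barenco) -/

/-- **`CNOT` on wires `(c, t)` from an adjacent-free `CZ` identity**: `CNOT_{ct} = H_t · CZ_{ct} · H_t`
(all placed). [cite: BarencoEtAl1995, §2] -/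
theorem placeGate_pairEmb_cnot_eq {c t : Fin n} (h : c ≠ t) :
    placeGate (pairEmb c t h) cnot = placeGate (wireEmb t) hGate * placeGate (pairEmb c t h) cz * placeGate (wireEmb t) hGate := by
  rw [Lemma24.cnot_eq_hadamard_cz_hadamard, placeGate_mul_holds, placeGate_mul_holds, placeGate_pairEmb_hOnSnd h]

/-- **Barenco's network for `CCZ`**: with the three wires `a = e 0`, `b = e 1`, `c = e 2`,
`CCZ = CP_{bc}(i) · (H_b CZ_{ab} H_b) · CP_{bc}(-i) · (H_b CZ_{ab} H_b) · CP_{ac}(i)` — every factor a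
placed `cphase`, `cz` or Hadamard. [cite: BarencoEtAl1995, Lemma 6.1 and Lemma 7.5] -/
theorem placeGate_ccsign_eq_prod (e : Fin 3 ↪ Fin n) :
    placeGate e ccsign =
      placeGate (pairEmb (e 1) (e 2) (fun h => by have := e.injective h; simp at this)) (cphase I) *
        ((placeGate (wireEmb (e 1)) hGate * placeGate (pairEmb (e 0) (e 1) (fun h => by have := e.injective h; simp at this)) cz *
            placeGate (wireEmb (e 1)) hGate) *
          placeGate (pairEmb (e 1) (e 2) (fun h => by have := e.injective h; simp at this)) (cphase (-I)) *
          (placeGate (wireEmb (e 1)) hGate * placeGate (pairEmb (e 0) (e 1) (fun h => by have := e.injective h; simp at this)) cz *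
            placeGate (wireEmb (e 1)) hGate)) *
        placeGate (pairEmb (e 0) (e 2) (fun h => by have := e.injective h; simp at this)) (cphase I) := by
  have h01 : e 0 ≠ e 1 := fun h => by have := e.injective h; simp at this
  have h02 : e 0 ≠ e 2 := fun h => by have := e.injective h; simp at this
  have h12 : e 1 ≠ e 2 := fun h => by have := e.injective h; simp at this
  have key := Barenco.mc_insert_diag_sq (C := ({e 0} : Finset (Fin n))) (a := e 1) (t := e 2) (by simp [h01.symm])
    (by simp [h02.symm]) h12 (v := I) (by simp)
  rw [show I * I = (-1 : ℂ) from Complex.I_mul_I, show (starRingEnd ℂ) I = -I from Complex.conj_I,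
    show insert (e 1) ({e 0} : Finset (Fin n)) = {e 0, e 1} from Finset.pair_comm _ _] at key
  rw [placeGate_ccsign_eq_mc, key, ← placeGate_pairEmb_cphase h12, ← placeGate_pairEmb_cphase h12,
    ← placeGate_pairEmb_cphase h02, Barenco.mc_singleton_pauliX h01, placeGate_pairEmb_cnot_eq h01]

end Literature.Computability.QuantumComplexity

end
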